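import Summits.QuantumFields.BalabanUV.T4Continuum.Support.ShellMeasureLandauHolonomyPrint
import Summits.QuantumFields.BalabanUV.T4Continuum.Support.ShellMeasureLandauLocalEndRay
import Summits.QuantumFields.BalabanUV.T4Continuum.Support.ShellMeasurePinnedNorm

/-!
# `T4Continuum.ShellMeasureLandauPinnedEndRay` — row S70 «END-II-loc», file 4b: file 3's two ENDs with the NON-WILSON
# PART AS A BINDER (`𝓔`, its 𝓔-ray pair `hE`∕`hB𝓔`, and a lower bound on the chart cube for `hfin`) — the slot S71's
# LOCATED supplier `ShellMeasureRayTermsPinnedLandau.hE_landau_chartRay_pinned` (volume-free `B𝓔`) fills; with it the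
# slot constant `2(m₀ + β·(L̄(0+4s̄)·K) + B𝓔)∕(1−δ)` has NO extensive entry left (`slotAC_realized_su2_landauChart_pinned_rayE`)
(cell `pub-balaban`, sub-cell `t4`, spine estimate NE7c (node U5b); NE7c ROUND-2 crew, unit
`b2b-balaban-t4-ne7c-formalise-leaf-01` gen 6, owner table `LEAVES-NE7c-P1.md` v3.0 row S70 (CLAIM journal l.16173);
ADDITIVE — imports the chain's file (G) `ShellMeasureLandauHolonomyPrint` (leaf-02 lineage; its §1–§3 lemmas BY NAME),
this row's file 4a `ShellMeasureLandauLocalEndRay` and the owner's S69 `ShellMeasurePinnedNorm` ONLY; §1's `hfin` is the print END's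
argument with the terms' bound replaced by the displayed lower bound `−B𝓔lb ≤ 𝓔 V y` on the cube (`weight_le_of_bounds`); [folklore]; 0 `def`,
0 `def … : Prop`, 0 sorry, 0 citations)

HONEST FRAMING.  Finite four-torus programme, rung (B)+1 only — NOT infinite volume, NOT a mass gap, NOT the Clay
problem, NOT summit progress; (B), `BetaPertHyp`, (B^μ) not consumed.  NE7c (`T4IndicatorShell.ShellWeightBound`) is
NOT PRINTED and NOT PROVED; «NE7c ⇐ the named binders»; (M1) realized ≠ NE7c (c3).  Nothing printed is asserted: the
equation numbers LOCATE the displayed SHAPES of binders, they are not citations.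

THE FINDING THIS FILE ANSWERS (owner F-ne7cp1-g30-1, GAPS l.25103; WALL v1.9 §2 (j) ∕ §3 W-h).  END-II of record
concludes (M1) with `D = 2(m₀ + β·Σ_{p∈P_w} L̄_p(0 + 4s̄_p) + 3H̄∕(Rad−1))∕(1−δ)` and p-UNIFORM `s̄_p = m_w κ_w z̄`,
`L̄_p = 3m_w κ_w z̄∕(Rad−1)`: at a live level `P_w` must hold every fine plaquette of the action, so `D ∝ #P_w` —
VOLUME-EXTENSIVE, and END-I's binder (j) `D_j ≤ D̄` is not inhabitable through it.  The repair keeps the composition and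
lets LOCALITY in through ONE slot: the weight read-out constant becomes PER PLAQUETTE (`κ_w(p)`, files 1–2), and decays
with the pin depth of the plaquette once the exponent fields carry S69's pinned norm; S69 `slotAntiConcentration_pinned`
then sums the ray budget VOLUME-FREE.
* §1 **`slotAC_realized_su2_landauChart_print_rayE`** — file 3 §1 with `𝓔`∕`hE`∕`hB𝓔`∕`h𝓔lb` binders in place of `I`∕`Ef`∕`hEd`∕`hEb`∕`hsum`∕`hcoupE` (proof: the print
  END's own steps — printed smallness ⇒ scheme numerics, (1.27) ball support ⇒ window, `hfin` a theorem — over file 2's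
  three-sided local END at `A := M_n(ℂ)`, `𝓡𝒴 := readOutReal L`).
* §2 **`slotAC_realized_su2_landauChart_pinned_rayE`** — §1 + the locality data (`ϖ_P ≥ 0`, `δ′ ≥ 0`,
  `κ_w(p) ≤ κ̄_w e^{−δ′ϖ_P(p)}`, `Σ_p e^{−δ′ϖ_P(p)} ≤ K`, `m_w κ̄_w z̄ ≤ 1`) ⟹ (M1) with
  `D = 2(m₀ + β·(L̄(0 + 4s̄)·K) + B𝓔)∕(1−δ)` — NO `#P_w`, and with S71's `B𝓔` NO `#I` either.
THE TWO NORMS (row text (i)–(v)) enter at the road's DICTIONARY, all DISPLAYED: `𝒴` := `WSup (pinW δ′ ϖ) 1 𝔄`; (v) the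
per-letter decay `κ_w(p)` = S69 (B); (ii) `h𝒢`∕`hH₁`∕`hH` pinned = S69 (A) over kernel-decay binders ((3.133) ∕ Thm 3.3 ∕
(46) TYPE); (iii) `solAt` contracts in whatever norm `𝒴` carries — with the pinned constants the smallness (118)∕(121) is
the printed one with `M_{δ₀−δ′}` in the row sums; (iv) `z_pin = z̄` of the pinned instance (`landauCurve_along`); (i) `Φ`
block-supported ⇒ `b` flat.  `hW`∕`hCq` in the pinned currency ⇐ decaying DERIVATIVE kernels ((98)∕(73) TYPE) by the mean
value theorem — a bridge, not needed by this END.  The non-Wilson budget `H̄` is S71's (`H̄_osc`, leaf-09-g11).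
NOTHING in the countdown moves; NE7c NOT PROVED; spine PROVED 0∕9.  HONEST DEPENDENCY (cell): continuum YM on T⁴ ⇐
BetaPertH ∧ nine spine estimates (0/9 proved); BetaPertH ⇐ (D1) ∧ (D4) ∧ CAP+tail; G-an2-4 gates asym, D1 and NE2/3/4.
-/

noncomputable section

open Set Metric NormedSpace MeasureTheory Function

namespace Summit.QuantumFields.BalabanUV.T4Continuum.ShellMeasureLandauPinnedEndRay

open scoped ENNReal
open Literature.MathematicalPhysics.QuantumFieldTheory.Balaban1983to89
open B11Prop6Scheme (Prop4Hyp)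
open GaugeField (GaugeInvariant)
open T4ShellMeasure (SlotAntiConcentration)
open T4CubePoincare (cube)
open T4CubeChartGnomonic (SU2)
open T4CubeChartExp (expJac expWindowDensity expFibreChart)
open T4ShellMeasureDet (blockLaw)
open T4TreeGaugeFixing (NoClosedLoop fixTo measurable_fixTo)
open ShellMeasureWilsonTrace (TraceData)
open ShellMeasureWilsonBlock (matrixTrace matrixTrace_N_pos)
open ShellMeasureLevelAssembly (classifier weight action)
open ShellMeasureLandauHolonomy (solAt landauExp)
open ShellMeasureLandauHolonomyChart (holOf holOf_apply cplx)
open ShellMeasureLandauHolonomySkew (readOutReal isClosed_readOutReal hℓr_matrix_readOutReal)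
open ShellMeasureLandauHolonomyPrint (hfin_of_cubeBound chartCube_subset_closedBall norm_wordExp_le_one
  weight_le_of_bounds)
open ShellMeasureLandauPrinted (scheme_numbers_of_printed sectC_numbers_of_printed)
open ShellMeasureWindowBall (window_of_ballSupport)
open ShellMeasureLandauLocalEndRay (slotAC_realized_su2_landauChart_threeSided_rayE)
open ShellMeasureLandauHolonomyReal (landauField_mem_real)
open ShellMeasurePinnedNorm (slotAntiConcentration_pinned)

section EndPinned

open scoped Matrix.Norms.L2Operator

variable {P : Params} {j : ℕ} [DecidableEq (PBond P j)]
variable {n : Type*} [Fintype n] [DecidableEq n] [Nonempty n]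
variable {𝒴 𝒴' 𝒳 𝒵 ℬ : Type*} [NormedAddCommGroup 𝒴] [NormedSpace ℂ 𝒴] [CompleteSpace 𝒴]
  [NormedAddCommGroup 𝒴'] [NormedSpace ℂ 𝒴'] [NormedAddCommGroup 𝒳] [NormedSpace ℂ 𝒳] [CompleteSpace 𝒳]
  [NormedAddCommGroup 𝒵] [NormedSpace ℂ 𝒵] [NormedAddCommGroup ℬ] [NormedSpace ℂ ℬ]

/-! ## §1 The print END with per-plaquette weight read-out constants -/

/-- **REALIZED (M1) PER SLOT ON THE LD CHAIN, READ IN PRINT, WITH PER-PLAQUETTE WEIGHT READ-OUT CONSTANTS** —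
`ShellMeasureLandauHolonomyPrint.slotAC_realized_su2_landauChart_print` VERBATIM except `κ_w : κ → ℝ`
(`hℓw : ‖ℓ Y‖ ≤ κ_w p·‖Y‖` for `ℓ ∈ ℓw p`, `hsw1` per plaquette).  CONCLUSION: E2′'s, with the slot constant's weight
sum now PER PLAQUETTE, `Σ_{p∈P_w} L̄_p(0 + 4s̄_p)`, `s̄_p = m_w κ_w(p) z̄`, `L̄_p = 3m_w κ_w(p) z̄∕(r_Φ∕S − 1)`.  Proof: the
print END's own (printed smallness ⇒ scheme numerics; ball support ⇒ window; `hfin` a theorem) over file 2's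
`slotAC_realized_su2_landauChart_threeSided_local` at `A := M_n(ℂ)`, `𝓡𝒴 := readOutReal L`.  A junction;
CONDITIONAL on every binder; nothing PRINTED is asserted; NOT Bałaban's minimiser; NE7c NOT PROVED. [folklore] -/
theorem slotAC_realized_su2_landauChart_print_rayE {T : Finset (PBond P j)} (hT : NoClosedLoop T)
    (U₀ : GaugeField P j SU2) (Λ : Finset (PBond P j)) {m₀ : ℕ} (e : ↥Λ × Fin 3 ≃ Fin m₀)
    {S : ℝ} (hS : 0 < S) (hSπ : 3 * S ^ 2 < Real.pi ^ 2) (c : GaugeField P j SU2 → GaugeField P j SU2)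
    {F : GaugeField P j SU2 → ℝ≥0∞} (hF : Measurable F) (hFi : GaugeInvariant F)
    -- print's (1.27) window as a SUPPORT property of the `T`-gauged sections (S20)
    (hFsupp : ∀ V y, F (fixTo T U₀ (updateFinset V Λ y)) ≠ 0 →
      ∀ b (hb : b ∈ Λ), dist1 ((c V b)⁻¹ * y ⟨b, hb⟩) ≤ 2 * Real.sin (S / 2))
    {u : GaugeField P j SU2 → ℝ} (hu : Measurable u) (hui : GaugeInvariant u)
    -- plaquette index sets, window, co-test
    {ι κ : Type*} {Pu : Finset ι} (hPu : Pu.Nonempty) (Pw : Finset κ)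
    (W : GaugeField P j SU2 → Set (Fin m₀ → ℝ)) (Jco : GaugeField P j SU2 → (Fin m₀ → ℝ) → ℝ≥0∞)
    {θ δ ρ β : ℝ}
    -- THE SCHEME OPERATORS per exterior section with V-uniform constants ((P2), (P4), (103), (75), (44), scaling, (46))
    (𝒢 : GaugeField P j SU2 → (𝒵 →L[ℂ] 𝒴)) (W𝒱 : GaugeField P j SU2 → 𝒴 → 𝒵) {B₀ C₄ a₃ ε₄ : ℝ}
    (h𝒢 : ∀ V f, ‖𝒢 V f‖ ≤ B₀ * ‖f‖) (hW : ∀ V, Prop4Hyp (W𝒱 V) C₄ a₃) (hB₀ : 0 < B₀) (hC₄ : 0 ≤ C₄)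
    (hε₄ : 0 ≤ ε₄)
    -- Prop. 6's PRINTED smallness (p. 295) with `dL ≤ B₃`; the coarse-field size `2dLC₁ε₁` of (75)
    {dL C₁ B₃ ε₁ : ℝ} (hdL : 0 ≤ dL) (hC₁ : 0 ≤ C₁) (hε₁ : 0 ≤ ε₁) (hB₃ : dL ≤ B₃)
    (h1 : 2 * B₀ * C₁ * B₃ * ε₁ ≤ ε₄) (h2 : 4 * ε₄ ≤ a₃) (h3 : 16 * B₀ * C₄ * ε₄ ≤ 1)
    (H₁ : GaugeField P j SU2 → (ℬ →L[ℂ] 𝒴)) (hH₁ : ∀ V B, ‖H₁ V B‖ ≤ B₀ * ‖B‖)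
    (Φ : GaugeField P j SU2 → (Fin m₀ → ℂ) → ℬ) {rΦ : ℝ} (hΦd : ∀ V, DifferentiableOn ℂ (Φ V) (ball 0 rΦ))
    (hΦ0 : ∀ V, Φ V 0 = 0) (hΦ : ∀ V, ∀ z ∈ ball (0 : Fin m₀ → ℂ) rΦ, ‖Φ V z‖ < 2 * dL * C₁ * ε₁) (hSr : S < rΦ)
    (Cf : GaugeField P j SU2 → 𝒴' → 𝒳) {C₂ RC : ℝ} (hC₂ : 0 ≤ C₂)
    (hCq : ∀ V, ∀ Z : 𝒴', ‖Z‖ < RC → ‖Cf V Z‖ ≤ C₂ * ‖Z‖ ^ 2) (hCd : ∀ V, DifferentiableOn ℂ (Cf V) (ball 0 RC))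
    (ιs : GaugeField P j SU2 → (𝒴 →L[ℂ] 𝒴')) (hι : ∀ V Y, ‖ιs V Y‖ ≤ ‖Y‖)
    (Hop : GaugeField P j SU2 → (𝒳 →L[ℂ] 𝒴)) (hH : ∀ V X, ‖Hop V X‖ ≤ B₀ * ‖X‖)
    -- Prop. 3's PRINTED smallness (p. 286) + the located coupling into its domain and B13's domain condition
    {ε₃ : ℝ} (h18 : 18 * C₂ * B₀ * ε₃ ≤ 1) (hcoup : ε₄ + B₀ * (2 * dL * C₁ * ε₁) ≤ ε₃) (h3R : 3 * ε₃ ≤ RC)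
    -- the classifier read-outs, the WEIGHT read-outs, the per-term functionals — values in `M_n(ℂ)`
    (ℓs : ι → List (𝒴 →L[ℂ] Matrix n n ℂ)) {κr : ℝ} (hκ : 0 ≤ κr)
    (hℓ : ∀ p ∈ Pu, ∀ ℓ ∈ ℓs p, ∀ Y, ‖ℓ Y‖ ≤ κr * ‖Y‖) {m : ℕ} (hlen : ∀ p ∈ Pu, (ℓs p).length ≤ m)
    (ℓw : κ → List (𝒴 →L[ℂ] Matrix n n ℂ)) {κw : κ → ℝ} (hκw : ∀ p ∈ Pw, 0 ≤ κw p)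
    (hℓw : ∀ p ∈ Pw, ∀ ℓ ∈ ℓw p, ∀ Y, ‖ℓ Y‖ ≤ κw p * ‖Y‖) {mw : ℕ} (hlenw : ∀ p ∈ Pw, (ℓw p).length ≤ mw)
    -- THE NON-WILSON PART AS A BINDER: any functional with its 𝓔-RAY PAIR (S71's located supplier fills it) and a
    -- LOWER BOUND on the chart cube (for the finiteness proviso only)
    (𝓔 : GaugeField P j SU2 → (Fin m₀ → ℝ) → ℝ) {B𝓔 B𝓔lb : ℝ}
    (hE : ∀ V, ∀ x ∈ W V, ∀ c' : ℝ, 1 / 2 ≤ c' → c' ≤ 1 → 𝓔 V (c' • x) ≤ 𝓔 V x + (1 - c') * B𝓔) (hB𝓔 : 0 ≤ B𝓔)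
    (h𝓔lb : ∀ V (y : Fin m₀ → ℝ), ‖y‖ ≤ S → -B𝓔lb ≤ 𝓔 V y)
    -- THE REAL STRUCTURE GENERATED BY A READ-OUT SET `L` containing the weight read-outs; its images; preservation
    (L : Set (𝒴 →L[ℂ] Matrix n n ℂ)) (hL : ∀ p ∈ Pw, ∀ ℓ ∈ ℓw p, ℓ ∈ L)
    (𝓡𝒵 : AddSubgroup 𝒵) (𝓡𝒴' : AddSubgroup 𝒴') (𝓡𝒳 : AddSubgroup 𝒳) (h𝓡𝒳 : IsClosed (𝓡𝒳 : Set 𝒳))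
    (𝓡ℬ : AddSubgroup ℬ)
    (h𝒢r : ∀ V, ∀ f ∈ 𝓡𝒵, 𝒢 V f ∈ readOutReal L) (hWr : ∀ V, ∀ Y ∈ readOutReal L, W𝒱 V Y ∈ 𝓡𝒵)
    (hιr : ∀ V, ∀ Y ∈ readOutReal L, ιs V Y ∈ 𝓡𝒴') (hHr : ∀ V, ∀ X ∈ 𝓡𝒳, Hop V X ∈ readOutReal L)
    (hCr : ∀ V, ∀ Z ∈ 𝓡𝒴', Cf V Z ∈ 𝓡𝒳) (hH₁r : ∀ V, ∀ B ∈ 𝓡ℬ, H₁ V B ∈ readOutReal L)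
    (hΦr : ∀ V, ∀ y : Fin m₀ → ℝ, ‖y‖ ≤ S → Φ V (cplx y) ∈ 𝓡ℬ)
    -- DICTIONARY (on the chart cube only): the density's OWN sections with the DEFINED weight words and non-Wilson
    -- term; the tested variable with the DEFINED classifier holonomies — all of the SAME exponent field
    (hRdict : ∀ V, ∀ x ∈ cube m₀ S,
      F (fixTo T U₀ (updateFinset V Λ (expFibreChart Λ (c V) e x))) = Jco V x * weight (matrixTrace (n := n)) β Pw
        (fun p => holOf (ℓw p) (fun y => landauExp (Cf V) (ιs V) (Hop V)
          (4 * C₂ * (ε₄ + B₀ * (2 * dL * C₁ * ε₁)) ^ 2)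
          (solAt (𝒢 V) 0 (W𝒱 V) ε₄ (0 : 𝒵) (H₁ V (Φ V (cplx y))) + H₁ V (Φ V (cplx y)))))
        (𝓔 V) x)
    (hudict : ∀ V, ∀ x ∈ cube m₀ S,
      u (fixTo T U₀ (updateFinset V Λ (expFibreChart Λ (c V) e x))) =
        classifier hPu (fun p => holOf (ℓs p) (fun y => landauExp (Cf V) (ιs V) (Hop V)
          (4 * C₂ * (ε₄ + B₀ * (2 * dL * C₁ * ε₁)) ^ 2)
          (solAt (𝒢 V) 0 (W𝒱 V) ε₄ (0 : 𝒵) (H₁ V (Φ V (cplx y))) + H₁ V (Φ V (cplx y))))) x)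
    -- co-tests: supported in the window, centre-monotone, AT MOST ONE; the window inside the chart ball
    (hJW : ∀ V x, Jco V x ≠ 0 → x ∈ W V)
    (hJ : ∀ V x, ∀ a : ℝ, 0 ≤ a → Jco V x ≤ Jco V (Real.exp (-a) • x))
    (hJ1 : ∀ V x, Jco V x ≤ 1)
    (hWS : ∀ V, W V ⊆ closedBall (0 : Fin m₀ → ℝ) S)
    -- numbers + the weight-side smallness + SM-L2 (SM) in the currency `Rad = r_Φ / S`
    (hθ : 0 < θ) (hδ0 : 0 ≤ δ) (hδ1 : δ < 1) (hρ0 : 0 ≤ ρ) (hρ : ρ ≤ (1 - δ) / 2) (hβ : 0 ≤ β)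
    (hsw1 : ∀ p ∈ Pw, mw * (κw p * ((ε₄ + B₀ * (2 * dL * C₁ * ε₁)) +
      B₀ * (4 * C₂ * (ε₄ + B₀ * (2 * dL * C₁ * ε₁)) ^ 2))) ≤ 1)
    (hSM : 36 * (Real.exp (m * (κr * ((ε₄ + B₀ * (2 * dL * C₁ * ε₁)) +
      B₀ * (4 * C₂ * (ε₄ + B₀ * (2 * dL * C₁ * ε₁)) ^ 2)))) - 1) * 1 ^ 2 / (rΦ / S - 1) ^ 2 ≤ δ * θ) :
    SlotAntiConcentration ((fieldMeasure P j SU2).withDensity F) u θ ρ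
      (2 * ((m₀ : ℝ) + (β * ∑ p ∈ Pw,
        (mw * (3 * (κw p * ((ε₄ + B₀ * (2 * dL * C₁ * ε₁)) +
          B₀ * (4 * C₂ * (ε₄ + B₀ * (2 * dL * C₁ * ε₁)) ^ 2))) / (rΦ / S - 1))) *
          (0 + 4 * (mw * (κw p * ((ε₄ + B₀ * (2 * dL * C₁ * ε₁)) +
            B₀ * (4 * C₂ * (ε₄ + B₀ * (2 * dL * C₁ * ε₁)) ^ 2))))) +
        B𝓔)) / (1 - δ)) := by
  -- the printed smallness gives the scheme numerics ((118)/(121) at the ray; (54) at `ε₄ + 2dLB₀C₁ε₁`)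
  obtain ⟨hdom, hself, hcontr, -⟩ := scheme_numbers_of_printed hdL hB₀.le hC₁ hC₄ hε₁ hε₄ hB₃ h1 h2 h3
  have hself' : B₀ * C₄ * (ε₄ + B₀ * (2 * dL * C₁ * ε₁)) ^ 2 ≤ ε₄ := by simpa using hself
  have hcontr' : 4 * B₀ * C₄ * (ε₄ + B₀ * (2 * dL * C₁ * ε₁)) < 1 := by simpa using hcontr
  obtain ⟨hq, hRC⟩ := sectC_numbers_of_printed hC₂ hB₀.le h18 hcoup h3R
  -- (LR)_j from the ball support (S20); the block weight is the density's own section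
  have hR : ∀ V, Measurable fun y : ↥Λ → SU2 => F (fixTo T U₀ (updateFinset V Λ y)) :=
    fun _ => hF.comp ((measurable_fixTo T U₀).comp measurable_updateFinset)
  have hFw := window_of_ballSupport T U₀ Λ c hS.le hFsupp
  -- the finiteness proviso: the density on the cube is co-test × a weight bounded by `e^{H̄/2}`
  have hfin : ∀ V, ((blockLaw Λ).withDensity fun y => F (fixTo T U₀ (updateFinset V Λ y))) univ ≠ ∞ := by
    refine hfin_of_cubeBound T U₀ Λ e hS hSπ c hR hFw (K := 1 * ENNReal.ofReal (Real.exp B𝓔lb))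
      (ENNReal.mul_ne_top ENNReal.one_ne_top ENNReal.ofReal_ne_top) fun V x hx => ?_
    show F (fixTo T U₀ (updateFinset V Λ (expFibreChart Λ (c V) e x))) ≤ _
    rw [hRdict V x hx]
    have hy : ‖x‖ ≤ S := mem_closedBall_zero_iff.1 (chartCube_subset_closedBall hS.le hx)
    refine mul_le_mul' (hJ1 V x)
      (weight_le_of_bounds (matrixTrace (n := n)) matrixTrace_N_pos hβ Pw (fun p hp => ?_) (h𝓔lb V x hy))
    -- the weight words contract: the exponent field at the real point is real, the read-outs skew, the letters unitary
    rw [holOf_apply]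
    refine norm_wordExp_le_one _ fun a ha => ?_
    obtain ⟨ℓ, hℓ, rfl⟩ := List.mem_map.1 ha
    have hZr := landauField_mem_real (h𝒢 V) (hW V) hB₀ hC₄ hε₄ hdom hself' hcontr' (H₁ V) (hH₁ V) (hΦ V) hSr
      hC₂ (hCq V) (hCd V) (ιs V) (hι V) (Hop V) (hH V) hq hRC (readOutReal L) (isClosed_readOutReal L) 𝓡𝒵 𝓡𝒴'
      𝓡𝒳 h𝓡𝒳 𝓡ℬ (h𝒢r V) (hWr V) (hιr V) (hHr V) (hCr V) (hH₁r V) (hΦr V) hy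
    exact (hℓr_matrix_readOutReal Pw ℓw L hL p hp ℓ hℓ _ hZr).2
  exact slotAC_realized_su2_landauChart_threeSided_rayE hT U₀ Λ e hS hSπ c hR hF hFi hFw hfin hu hui
    (matrixTrace (n := n)) matrixTrace_N_pos hPu Pw W Jco 𝒢 W𝒱 h𝒢 hW hB₀ hC₄ hε₄ hdom hself' hcontr' H₁ hH₁ Φ hΦd
    hΦ0 hΦ hSr Cf hC₂ hCq hCd ιs hι Hop hH hq hRC ℓs hκ hℓ hlen ℓw hκw hℓw hlenw 𝓔 hE hB𝓔
    (readOutReal L) (isClosed_readOutReal L) 𝓡𝒵 𝓡𝒴' 𝓡𝒳 h𝓡𝒳 𝓡ℬ h𝒢r hWr hιr hHr hCr hH₁r hΦr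
    (hℓr_matrix_readOutReal Pw ℓw L hL) hRdict hudict hJW hJ hWS hθ hδ0 hδ1 hρ0 hρ hβ hsw1 hSM

/-! ## §2 The volume-free END under pinned decay of the read-out constants -/

/-- **END-II-loc — REALIZED (M1) PER SLOT WITH A VOLUME-FREE SLOT CONSTANT (row S70's END).**  The print END with
per-plaquette weight read-out constants (§1) plus THE LOCALITY DATA: a pin profile `ϖ_P ≥ 0` on the weight
plaquettes, a rate `δ′ ≥ 0`, the DECAY of the read-out constants `κ_w(p) ≤ κ̄_w·e^{−δ′ϖ_P(p)}` and the located sum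
`Σ_{p∈P_w} e^{−δ′ϖ_P(p)} ≤ K`; then `P_w` may hold EVERY plaquette of the action and the conclusion is (M1) with
`D = 2(m₀ + β·(L̄·(0 + 4s̄)·K) + 3H̄∕(r_Φ∕S − 1))∕(1−δ)`, `s̄ = m_w κ̄_w z̄`, `L̄ = 3m_w κ̄_w z̄∕(r_Φ∕S − 1)` — NO `#P_w`, NO
volume (S69 `ShellMeasurePinnedNorm.slotAntiConcentration_pinned`).  WHERE THE DECAY COMES FROM (the locality road's
dictionary, node O — DISPLAYED, not discharged here): `𝒴` = S69's pinned space `WSup (pinW δ′ ϖ) 1 𝔄` of exponent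
fields; a weight read-out of plaquette `p` is blind off the bonds of `p` at pin depth `ϖ_P(p)` ⇒ `κ_w(p) ≤ κ̄_w e^{−δ′ϖ_P(p)}`
(`ShellMeasurePinnedNorm.norm_readOut_le_of_blind`); the operator binders `h𝒢`∕`hH₁`∕`hH` in that currency = kernels with
DISPLAYED decay ((3.133) ∕ [5] Thm 3.3 ∕ (46) TYPE) through `ShellMeasurePinnedNorm.opNorm_kerOpPin_le`; `hW`∕`hCq` in that
currency from decaying DERIVATIVE kernels ((98)∕(73) TYPE); `Φ V` block-supported (pin depth 0) so `b` is its flat size;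
`K = #B₀·m·K₁ d δ′` on the torus (`ShellMeasurePinnedNorm.sum_exp_neg_pinDist_le`).  A junction; CONDITIONAL on every
binder; nothing PRINTED is asserted; NOT Bałaban's minimiser or effective action; NE7c NOT PROVED. [folklore] -/
theorem slotAC_realized_su2_landauChart_pinned_rayE {T : Finset (PBond P j)} (hT : NoClosedLoop T)
    (U₀ : GaugeField P j SU2) (Λ : Finset (PBond P j)) {m₀ : ℕ} (e : ↥Λ × Fin 3 ≃ Fin m₀)
    {S : ℝ} (hS : 0 < S) (hSπ : 3 * S ^ 2 < Real.pi ^ 2) (c : GaugeField P j SU2 → GaugeField P j SU2)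
    {F : GaugeField P j SU2 → ℝ≥0∞} (hF : Measurable F) (hFi : GaugeInvariant F)
    -- print's (1.27) window as a SUPPORT property of the `T`-gauged sections (S20)
    (hFsupp : ∀ V y, F (fixTo T U₀ (updateFinset V Λ y)) ≠ 0 →
      ∀ b (hb : b ∈ Λ), dist1 ((c V b)⁻¹ * y ⟨b, hb⟩) ≤ 2 * Real.sin (S / 2))
    {u : GaugeField P j SU2 → ℝ} (hu : Measurable u) (hui : GaugeInvariant u)
    -- plaquette index sets, window, co-test
    {ι κ : Type*} {Pu : Finset ι} (hPu : Pu.Nonempty) (Pw : Finset κ)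
    (W : GaugeField P j SU2 → Set (Fin m₀ → ℝ)) (Jco : GaugeField P j SU2 → (Fin m₀ → ℝ) → ℝ≥0∞)
    {θ δ ρ β : ℝ}
    -- THE SCHEME OPERATORS per exterior section with V-uniform constants ((P2), (P4), (103), (75), (44), scaling, (46))
    (𝒢 : GaugeField P j SU2 → (𝒵 →L[ℂ] 𝒴)) (W𝒱 : GaugeField P j SU2 → 𝒴 → 𝒵) {B₀ C₄ a₃ ε₄ : ℝ}
    (h𝒢 : ∀ V f, ‖𝒢 V f‖ ≤ B₀ * ‖f‖) (hW : ∀ V, Prop4Hyp (W𝒱 V) C₄ a₃) (hB₀ : 0 < B₀) (hC₄ : 0 ≤ C₄)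
    (hε₄ : 0 ≤ ε₄)
    -- Prop. 6's PRINTED smallness (p. 295) with `dL ≤ B₃`; the coarse-field size `2dLC₁ε₁` of (75)
    {dL C₁ B₃ ε₁ : ℝ} (hdL : 0 ≤ dL) (hC₁ : 0 ≤ C₁) (hε₁ : 0 ≤ ε₁) (hB₃ : dL ≤ B₃)
    (h1 : 2 * B₀ * C₁ * B₃ * ε₁ ≤ ε₄) (h2 : 4 * ε₄ ≤ a₃) (h3 : 16 * B₀ * C₄ * ε₄ ≤ 1)
    (H₁ : GaugeField P j SU2 → (ℬ →L[ℂ] 𝒴)) (hH₁ : ∀ V B, ‖H₁ V B‖ ≤ B₀ * ‖B‖)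
    (Φ : GaugeField P j SU2 → (Fin m₀ → ℂ) → ℬ) {rΦ : ℝ} (hΦd : ∀ V, DifferentiableOn ℂ (Φ V) (ball 0 rΦ))
    (hΦ0 : ∀ V, Φ V 0 = 0) (hΦ : ∀ V, ∀ z ∈ ball (0 : Fin m₀ → ℂ) rΦ, ‖Φ V z‖ < 2 * dL * C₁ * ε₁) (hSr : S < rΦ)
    (Cf : GaugeField P j SU2 → 𝒴' → 𝒳) {C₂ RC : ℝ} (hC₂ : 0 ≤ C₂)
    (hCq : ∀ V, ∀ Z : 𝒴', ‖Z‖ < RC → ‖Cf V Z‖ ≤ C₂ * ‖Z‖ ^ 2) (hCd : ∀ V, DifferentiableOn ℂ (Cf V) (ball 0 RC))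
    (ιs : GaugeField P j SU2 → (𝒴 →L[ℂ] 𝒴')) (hι : ∀ V Y, ‖ιs V Y‖ ≤ ‖Y‖)
    (Hop : GaugeField P j SU2 → (𝒳 →L[ℂ] 𝒴)) (hH : ∀ V X, ‖Hop V X‖ ≤ B₀ * ‖X‖)
    -- Prop. 3's PRINTED smallness (p. 286) + the located coupling into its domain and B13's domain condition
    {ε₃ : ℝ} (h18 : 18 * C₂ * B₀ * ε₃ ≤ 1) (hcoup : ε₄ + B₀ * (2 * dL * C₁ * ε₁) ≤ ε₃) (h3R : 3 * ε₃ ≤ RC)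
    -- the classifier read-outs, the WEIGHT read-outs, the per-term functionals — values in `M_n(ℂ)`
    (ℓs : ι → List (𝒴 →L[ℂ] Matrix n n ℂ)) {κr : ℝ} (hκ : 0 ≤ κr)
    (hℓ : ∀ p ∈ Pu, ∀ ℓ ∈ ℓs p, ∀ Y, ‖ℓ Y‖ ≤ κr * ‖Y‖) {m : ℕ} (hlen : ∀ p ∈ Pu, (ℓs p).length ≤ m)
    (ℓw : κ → List (𝒴 →L[ℂ] Matrix n n ℂ)) {κw : κ → ℝ} (hκw : ∀ p ∈ Pw, 0 ≤ κw p)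
    (hℓw : ∀ p ∈ Pw, ∀ ℓ ∈ ℓw p, ∀ Y, ‖ℓ Y‖ ≤ κw p * ‖Y‖) {mw : ℕ} (hlenw : ∀ p ∈ Pw, (ℓw p).length ≤ mw)
    -- THE NON-WILSON PART AS A BINDER: any functional with its 𝓔-RAY PAIR (S71's located supplier fills it) and a
    -- LOWER BOUND on the chart cube (for the finiteness proviso only)
    (𝓔 : GaugeField P j SU2 → (Fin m₀ → ℝ) → ℝ) {B𝓔 B𝓔lb : ℝ}
    (hE : ∀ V, ∀ x ∈ W V, ∀ c' : ℝ, 1 / 2 ≤ c' → c' ≤ 1 → 𝓔 V (c' • x) ≤ 𝓔 V x + (1 - c') * B𝓔) (hB𝓔 : 0 ≤ B𝓔)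
    (h𝓔lb : ∀ V (y : Fin m₀ → ℝ), ‖y‖ ≤ S → -B𝓔lb ≤ 𝓔 V y)
    -- THE REAL STRUCTURE GENERATED BY A READ-OUT SET `L` containing the weight read-outs; its images; preservation
    (L : Set (𝒴 →L[ℂ] Matrix n n ℂ)) (hL : ∀ p ∈ Pw, ∀ ℓ ∈ ℓw p, ℓ ∈ L)
    (𝓡𝒵 : AddSubgroup 𝒵) (𝓡𝒴' : AddSubgroup 𝒴') (𝓡𝒳 : AddSubgroup 𝒳) (h𝓡𝒳 : IsClosed (𝓡𝒳 : Set 𝒳))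
    (𝓡ℬ : AddSubgroup ℬ)
    (h𝒢r : ∀ V, ∀ f ∈ 𝓡𝒵, 𝒢 V f ∈ readOutReal L) (hWr : ∀ V, ∀ Y ∈ readOutReal L, W𝒱 V Y ∈ 𝓡𝒵)
    (hιr : ∀ V, ∀ Y ∈ readOutReal L, ιs V Y ∈ 𝓡𝒴') (hHr : ∀ V, ∀ X ∈ 𝓡𝒳, Hop V X ∈ readOutReal L)
    (hCr : ∀ V, ∀ Z ∈ 𝓡𝒴', Cf V Z ∈ 𝓡𝒳) (hH₁r : ∀ V, ∀ B ∈ 𝓡ℬ, H₁ V B ∈ readOutReal L)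
    (hΦr : ∀ V, ∀ y : Fin m₀ → ℝ, ‖y‖ ≤ S → Φ V (cplx y) ∈ 𝓡ℬ)
    -- DICTIONARY (on the chart cube only): the density's OWN sections with the DEFINED weight words and non-Wilson
    -- term; the tested variable with the DEFINED classifier holonomies — all of the SAME exponent field
    (hRdict : ∀ V, ∀ x ∈ cube m₀ S,
      F (fixTo T U₀ (updateFinset V Λ (expFibreChart Λ (c V) e x))) = Jco V x * weight (matrixTrace (n := n)) β Pw
        (fun p => holOf (ℓw p) (fun y => landauExp (Cf V) (ιs V) (Hop V)
          (4 * C₂ * (ε₄ + B₀ * (2 * dL * C₁ * ε₁)) ^ 2)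
          (solAt (𝒢 V) 0 (W𝒱 V) ε₄ (0 : 𝒵) (H₁ V (Φ V (cplx y))) + H₁ V (Φ V (cplx y)))))
        (𝓔 V) x)
    (hudict : ∀ V, ∀ x ∈ cube m₀ S,
      u (fixTo T U₀ (updateFinset V Λ (expFibreChart Λ (c V) e x))) =
        classifier hPu (fun p => holOf (ℓs p) (fun y => landauExp (Cf V) (ιs V) (Hop V)
          (4 * C₂ * (ε₄ + B₀ * (2 * dL * C₁ * ε₁)) ^ 2)
          (solAt (𝒢 V) 0 (W𝒱 V) ε₄ (0 : 𝒵) (H₁ V (Φ V (cplx y))) + H₁ V (Φ V (cplx y))))) x)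
    -- co-tests: supported in the window, centre-monotone, AT MOST ONE; the window inside the chart ball
    (hJW : ∀ V x, Jco V x ≠ 0 → x ∈ W V)
    (hJ : ∀ V x, ∀ a : ℝ, 0 ≤ a → Jco V x ≤ Jco V (Real.exp (-a) • x))
    (hJ1 : ∀ V x, Jco V x ≤ 1)
    (hWS : ∀ V, W V ⊆ closedBall (0 : Fin m₀ → ℝ) S)
    -- numbers + the weight-side smallness + SM-L2 (SM) in the currency `Rad = r_Φ / S`
    (hθ : 0 < θ) (hδ0 : 0 ≤ δ) (hδ1 : δ < 1) (hρ0 : 0 ≤ ρ) (hρ : ρ ≤ (1 - δ) / 2) (hβ : 0 ≤ β)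
    -- THE LOCALITY DATA: a pin profile on the weight plaquettes, the decay of their read-out constants, the located sum
    (ϖP : κ → ℝ) {κbar δ' K : ℝ} (hκbar : 0 ≤ κbar) (hδ' : 0 ≤ δ') (hϖP : ∀ p ∈ Pw, 0 ≤ ϖP p)
    (hκle : ∀ p ∈ Pw, κw p ≤ κbar * Real.exp (-(δ' * ϖP p)))
    (hK : ∑ p ∈ Pw, Real.exp (-(δ' * ϖP p)) ≤ K)
    (hsw1 : mw * (κbar * ((ε₄ + B₀ * (2 * dL * C₁ * ε₁)) +
      B₀ * (4 * C₂ * (ε₄ + B₀ * (2 * dL * C₁ * ε₁)) ^ 2))) ≤ 1)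
    (hSM : 36 * (Real.exp (m * (κr * ((ε₄ + B₀ * (2 * dL * C₁ * ε₁)) +
      B₀ * (4 * C₂ * (ε₄ + B₀ * (2 * dL * C₁ * ε₁)) ^ 2)))) - 1) * 1 ^ 2 / (rΦ / S - 1) ^ 2 ≤ δ * θ) :
    SlotAntiConcentration ((fieldMeasure P j SU2).withDensity F) u θ ρ
      (2 * ((m₀ : ℝ) + (β * ((mw * (3 * (κbar * ((ε₄ + B₀ * (2 * dL * C₁ * ε₁)) +
          B₀ * (4 * C₂ * (ε₄ + B₀ * (2 * dL * C₁ * ε₁)) ^ 2))) / (rΦ / S - 1))) *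
          (0 + 4 * (mw * (κbar * ((ε₄ + B₀ * (2 * dL * C₁ * ε₁)) +
            B₀ * (4 * C₂ * (ε₄ + B₀ * (2 * dL * C₁ * ε₁)) ^ 2))))) * K) +
        B𝓔)) / (1 - δ)) := by
  -- abbreviation of the field size `z̄`
  set zb : ℝ := (ε₄ + B₀ * (2 * dL * C₁ * ε₁)) + B₀ * (4 * C₂ * (ε₄ + B₀ * (2 * dL * C₁ * ε₁)) ^ 2) with hzb
  have hRad : 1 < rΦ / S := by rw [lt_div_iff₀ hS]; linarith
  have hb : 0 < 2 * dL * C₁ * ε₁ := by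
    obtain ⟨V⟩ : Nonempty (GaugeField P j SU2) := ⟨fun _ => 1⟩
    exact (norm_nonneg _).trans_lt (hΦ V 0 (mem_ball_self (hS.trans hSr)))
  have hz : 0 ≤ zb := by rw [hzb]; positivity
  have hexp1 : ∀ p ∈ Pw, Real.exp (-(δ' * ϖP p)) ≤ 1 := fun p hp =>
    Real.exp_le_one_iff.2 (by nlinarith [hϖP p hp])
  have hκle' : ∀ p ∈ Pw, κw p ≤ κbar := fun p hp =>
    (hκle p hp).trans ((mul_le_mul_of_nonneg_left (hexp1 p hp) hκbar).trans_eq (mul_one _))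
  -- the per-plaquette END (§1) under the per-plaquette smallness inherited from `κ̄_w`
  have hsw1' : ∀ p ∈ Pw, mw * (κw p * zb) ≤ 1 := fun p hp =>
    (mul_le_mul_of_nonneg_left (mul_le_mul_of_nonneg_right (hκle' p hp) hz) (Nat.cast_nonneg _)).trans hsw1
  have h := slotAC_realized_su2_landauChart_print_rayE hT U₀ Λ e hS hSπ c hF hFi hFsupp hu hui hPu Pw W Jco 𝒢 W𝒱
    h𝒢 hW hB₀ hC₄ hε₄ hdL hC₁ hε₁ hB₃ h1 h2 h3 H₁ hH₁ Φ hΦd hΦ0 hΦ hSr Cf hC₂ hCq hCd ιs hι Hop hH h18 hcoup h3R ℓs hκ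
    hℓ hlen ℓw hκw hℓw hlenw 𝓔 hE hB𝓔 h𝓔lb L hL 𝓡𝒵 𝓡𝒴' 𝓡𝒳 h𝓡𝒳 𝓡ℬ h𝒢r hWr hιr hHr hCr hH₁r hΦr hRdict
    hudict hJW hJ hJ1 hWS hθ hδ0 hδ1 hρ0 hρ hβ hsw1' hSM
  -- S69: the per-plaquette ray budget is pinned ⇒ VOLUME-FREE
  exact slotAntiConcentration_pinned (μ' := (fieldMeasure P j SU2).withDensity F) (u := u) Pw
    (fun p => mw * (3 * (κw p * zb) / (rΦ / S - 1))) (fun _ => (0 : ℝ)) (fun p => mw * (κw p * zb)) ϖP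
    (n := (m₀ : ℝ)) (β := β) (B𝓔 := B𝓔) (θ := θ) (ρ := ρ) (δ := δ)
    (ℓ₀ := mw * (3 * (κbar * zb) / (rΦ / S - 1))) (dbar := 0) (sbar := mw * (κbar * zb)) (δ' := δ') (K := K)
    hβ hρ0 hδ1 (by positivity) le_rfl (by positivity)
    (fun p hp => by
      have e1 : (mw : ℝ) * (3 * (κw p * zb) / (rΦ / S - 1)) = (mw * (3 * zb / (rΦ / S - 1))) * κw p := by ring
      have e2 : (mw : ℝ) * (3 * (κbar * zb) / (rΦ / S - 1)) * Real.exp (-(δ' * ϖP p))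
          = (mw * (3 * zb / (rΦ / S - 1))) * (κbar * Real.exp (-(δ' * ϖP p))) := by ring
      rw [e1, e2]
      exact mul_le_mul_of_nonneg_left (hκle p hp)
        (mul_nonneg (Nat.cast_nonneg _) (div_nonneg (by positivity) (by linarith))))
    (fun _ _ => le_rfl) (fun _ _ => le_rfl)
    (fun p hp => mul_nonneg (Nat.cast_nonneg _) (mul_nonneg (hκw p hp) hz))
    (fun p hp => mul_le_mul_of_nonneg_left (mul_le_mul_of_nonneg_right (hκle' p hp) hz) (Nat.cast_nonneg _))
    hK h

end EndPinned

end Summit.QuantumFields.BalabanUV.T4Continuum.ShellMeasureLandauPinnedEndRay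

end
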